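import Literature.Combinatorics.Optimization.PsdRankBasicProperties
import HarnessLib

/-!
# Geometry of minimal psd rank: MIN PSD RANK (Gouveia–Robinson–Thomas 2015, §4, Prop. 4.4–4.5)

Source: J. Gouveia, R. Z. Robinson, R. R. Thomas, *Worst-case results for positive semidefinite
rank*, Math. Program. 153 (2015) 201–212 = arXiv:1305.4600 [GouveiaRobinsonThomas2015]; held text
`paper:arxiv-1305.4600`, p08–p09 (`pNN` = held-text chunk).

The setting (p08, verbatim): "Let `M ∈ ℝ^{p×q}` be a nonnegative matrix of rank `d = C(k+1, 2)`. Then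
by a dimension count, `rank_psd(M) ≥ k`. Thus we can ask the following decision problem about `M`:
Definition 4.3. MIN PSD RANK: Given a nonnegative matrix `M` of rank `C(k+1, 2)`, is
`rank_psd(M) = k`? [...] Let `M = UV` be a rank factorization and let `P, Q` be the cones
`P = cone(u_1, …, u_p)` and `Q = {x ∈ ℝ^d | xᵀV ≥ 0}` where `u_i` are the rows of `U`. Then `P`
and `Q` are `d`-dimensional cones with `P ⊆ Q` and `M = S_{P,Q}` [...]
**Proposition 4.4.** The psd rank of `M` is `k` if and only if there is an invertible linear map
`π : S^k → ℝ^d` such that `P ⊆ π(S^k_+) ⊆ Q`."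
and (p09, verbatim): "Consider the basis of `S^k` given by the elementary symmetric matrices `E_ij`
[...] `E_ii` the matrix with a one in position `(i,i)` [...] For `i < j`, let `E_ij` be the matrix
with `1/√2` in positions `(i,j)` and `(j,i)` [...] This basis allows a natural bijection between
`S^k` and `ℝ^d` by identifying a symmetric matrix `Y = Σ_{i≤j} E_ij y_ij` with the vector
`y = (y_ij) ∈ ℝ^d`. Note that this bijection preserves the inner product [...] Let `L` be the
nonsingular matrix representing the invertible linear map `π` with respect to the above basis. Then
`π(Y) = Ly` [...] The condition that `P ⊆ π(S^k_+)` is equivalent to `π⁻¹(u_i) ∈ S^k_+` for every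
generator `u_i` of `P`. [...] The condition `π(S^k_+) ⊆ Q` says that [...] for every matrix
`A ∈ S^k_+`, `v_jᵀ(π(A)) ≥ 0`. Therefore, we get that for every column `v_j` of `V`, the symmetric
matrix corresponding to `v_jᵀL` is psd. [...]
**Proposition 4.5.** The matrix `M` has psd rank `k` if and only if there are two matrices
`L, K ∈ ℝ^{d×d}` such that `L` is the inverse of `K`, i.e., `LK = KL = I`, the `k × k` linear
matrix inequality `Ku_i ⪰ 0` holds for each row `u_i` of `U`, the `k × k` linear matrix inequality
`v_jᵀL ⪰ 0` holds for each column `v_j` of `V`."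

## Formalization

* `ℝ^d`, `d = C(k+1,2)`, is indexed by `SymIdx k = {(s,t) : s ≤ t}` (`card_symIdx`); the printed
  inner-product preserving bijection `ℝ^d ≅ S^k` is the linear map `symOfVec` (`y ↦ Σ y_ij E_ij`),
  with inverse coordinates `vecOfSym` on symmetric matrices (`vecOfSym_symOfVec`,
  `symOfVec_vecOfSym`) and `trace_symOfVec_mul_symOfVec : ⟨π₀ y, π₀ z⟩ = yᵀz`.
* A rank factorization `M = UV` of a matrix of rank `d` is a pair
  `U : Matrix (Fin p) (SymIdx k) ℝ`, `V : Matrix (SymIdx k) (Fin q) ℝ` with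
  `rank (U V) = |SymIdx k|` (every matrix of rank `C(k+1,2)` has one:
  `exists_rank_factorization_of_card_eq` with `card_symIdx`); in the tree's vocabulary
  (`PsdRankBasicProperties.lean`: no `psdRank` function) "`rank_psd(M) = k`" for such an `M` is
  `HasPsdFactorization (U * V) k`, the dimension count "`rank_psd(M) ≥ k`" being
  `le_of_hasPsdFactorization_of_rank_eq` (from `HasPsdFactorization.rank_le_choose`, FGPRT Prop. 2.5).
* The cones: `rowCone U = cone(u_1,…,u_p)`, `colDualCone V = {x | xᵀV ≥ 0}`, and
  `psdConeImage L = π(S^k_+) = {Ly : π₀(y) ⪰ 0}` for the map `π` with matrix `L`.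
* `GouveiaRobinsonThomas2015_prop45` — Proposition 4.5, PROVED; `GouveiaRobinsonThomas2015_prop44` —
  Proposition 4.4, PROVED from it and the self-duality of `S^k_+` in coordinates
  (`posSemidef_symOfVec_iff`, the p09 sentence "for every column `v_j` of `V`, the symmetric matrix
  corresponding to `v_jᵀL` is psd").

Proof route (the paper's "using Proposition 3.6 and counting dimensions", made explicit and
matrix-level): a psd factorization of size `k` is a factorization `M = Â B̂` through `ℝ^d` in the
coordinates `vecOfSym` (as in FGPRT Prop. 2.5, `FawziEtAl2015_prop25_rank_holds`); since
`rank M = d`, both `M = UV` and `M = Â B̂` are rank factorizations, and two rank factorizations of one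
matrix differ by an invertible `d × d` matrix (`Â = UG`, `B̂ = G⁻¹V`; one-sided inverses of full-rank
rectangular matrices) — that matrix is `π`. Nonnegativity of `M` is not needed for the equivalences.
Not transcribed: Proposition 4.1 (half-conics, `k = 2`), Theorem 4.6 (Renegar's algorithm; BSS
complexity).
-/

noncomputable section

open Matrix Finset

open scoped MatrixOrder

namespace Literature.Combinatorics.Optimization

/-! ### `S^k ≅ ℝ^{C(k+1,2)}`: the coordinates of p09 -/

/-- The index set `{(s,t) : s ≤ t}` of `ℝ^d`, `d = C(k+1,2)`: the positions of the basis `E_ij`,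
`i ≤ j`, of `S^k`. [cite: GouveiaRobinsonThomas2015, §4 (p09, the basis E_ij, i ≤ j)] -/
abbrev SymIdx (k : ℕ) : Type := {p : Fin k × Fin k // p.1 ≤ p.2}

/-- `|{(s,t) : s ≤ t}| = C(k+1, 2)` (`= d`, p08). [cite: GouveiaRobinsonThomas2015, §4 (p08, d = C(k+1,2))] -/
theorem card_symIdx (k : ℕ) : Fintype.card (SymIdx k) = (k + 1).choose 2 := by
  rw [← Fintype.card_congr (Sym2.sortEquiv (α := Fin k)), Sym2.card, Fintype.card_fin]

/-- The unordered position `{s,t}` as an element of `SymIdx k`.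
[cite: GouveiaRobinsonThomas2015, §4 (p09, positions (i,j) and (j,i) of E_ij)] -/
def symIdxOf {k : ℕ} (s t : Fin k) : SymIdx k := ⟨(min s t, max s t), min_le_max⟩

/-- `{s,t} = {t,s}`. [cite: GouveiaRobinsonThomas2015, §4 (p09)] -/
theorem symIdxOf_comm {k : ℕ} (s t : Fin k) : symIdxOf s t = symIdxOf t s := by
  apply Subtype.ext
  simp only [symIdxOf, min_comm, max_comm]

/-- `{s,t} = (s,t)` for `s ≤ t`. [cite: GouveiaRobinsonThomas2015, §4 (p09)] -/
theorem symIdxOf_of_le {k : ℕ} {s t : Fin k} (h : s ≤ t) : symIdxOf s t = ⟨(s, t), h⟩ := by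
  apply Subtype.ext
  simp only [symIdxOf, min_eq_left h, max_eq_right h]

/-- `π₀ : ℝ^d → S^k`, `y ↦ Σ_{i≤j} y_ij E_ij` with `E_ii = e_ie_iᵀ`, `E_ij = (e_ie_jᵀ + e_je_iᵀ)/√2`
(`i < j`): the symmetric matrix with diagonal `y_ss` and off-diagonal entries `y_{st}/√2`; a linear
map. [cite: GouveiaRobinsonThomas2015, §4 (p09, "identifying a symmetric matrix Y = Σ E_ij y_ij with the vector y")] -/
def symOfVec {k : ℕ} : (SymIdx k → ℝ) →ₗ[ℝ] Matrix (Fin k) (Fin k) ℝ where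
  toFun y := Matrix.of fun s t => if s = t then y (symIdxOf s t) else y (symIdxOf s t) / Real.sqrt 2
  map_add' y z := by
    ext s t
    simp only [Matrix.of_apply, Pi.add_apply, Matrix.add_apply]
    split_ifs <;> ring
  map_smul' c y := by
    ext s t
    simp only [Matrix.of_apply, Pi.smul_apply, Matrix.smul_apply, smul_eq_mul, RingHom.id_apply]
    split_ifs <;> ring

/-- The coordinates of a symmetric matrix in the basis `E_ij`: `A ↦ ((A_ss)_s, (√2 A_st)_{s<t})`.
[cite: GouveiaRobinsonThomas2015, §4 (p09, the bijection S^k ≅ ℝ^d)] -/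
def vecOfSym {k : ℕ} (A : Matrix (Fin k) (Fin k) ℝ) : SymIdx k → ℝ :=
  fun q => if q.1.1 = q.1.2 then A q.1.1 q.1.2 else Real.sqrt 2 * A q.1.1 q.1.2

/-- Entries of `π₀ y`. [cite: GouveiaRobinsonThomas2015, §4 (p09)] -/
theorem symOfVec_apply {k : ℕ} (y : SymIdx k → ℝ) (s t : Fin k) :
    symOfVec y s t = if s = t then y (symIdxOf s t) else y (symIdxOf s t) / Real.sqrt 2 := rfl

/-- `π₀ y` is symmetric. [cite: GouveiaRobinsonThomas2015, §4 (p09)] -/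
theorem symOfVec_transpose {k : ℕ} (y : SymIdx k → ℝ) : (symOfVec y)ᵀ = symOfVec y := by
  ext s t
  rw [transpose_apply, symOfVec_apply, symOfVec_apply, symIdxOf_comm t s]
  by_cases h : s = t
  · subst h; rfl
  · rw [if_neg h, if_neg (Ne.symm h)]

/-- `π₀ y` is Hermitian (real symmetric). [cite: GouveiaRobinsonThomas2015, §4 (p09)] -/
theorem symOfVec_isHermitian {k : ℕ} (y : SymIdx k → ℝ) : (symOfVec y).IsHermitian := by
  rw [IsHermitian, conjTranspose_eq_transpose_of_trivial, symOfVec_transpose]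

/-- `vec ∘ π₀ = id`. [cite: GouveiaRobinsonThomas2015, §4 (p09, "a natural bijection between S^k and ℝ^d")] -/
theorem vecOfSym_symOfVec {k : ℕ} (y : SymIdx k → ℝ) : vecOfSym (symOfVec y) = y := by
  funext q
  obtain ⟨⟨s, t⟩, hst⟩ := q
  have h2 : Real.sqrt 2 ≠ 0 := Real.sqrt_ne_zero'.mpr two_pos
  simp only [vecOfSym, symOfVec_apply]
  rw [symIdxOf_of_le hst]
  by_cases h : s = t
  · rw [if_pos h, if_pos h]
  · rw [if_neg h, if_neg h]
    field_simp

/-- `π₀ ∘ vec = id` on symmetric matrices. [cite: GouveiaRobinsonThomas2015, §4 (p09)] -/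
theorem symOfVec_vecOfSym {k : ℕ} {A : Matrix (Fin k) (Fin k) ℝ} (hA : Aᵀ = A) :
    symOfVec (vecOfSym A) = A := by
  have hsym : ∀ a b, A b a = A a b := fun a b => by rw [← transpose_apply A a b, hA]
  have h2 : Real.sqrt 2 ≠ 0 := Real.sqrt_ne_zero'.mpr two_pos
  ext s t
  rw [symOfVec_apply]
  by_cases h : s = t
  · subst h
    rw [if_pos rfl, symIdxOf_of_le le_rfl]
    simp [vecOfSym]
  · rw [if_neg h]
    rcases lt_or_gt_of_ne h with hlt | hgt
    · rw [symIdxOf_of_le hlt.le]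
      simp only [vecOfSym]
      rw [if_neg h]
      field_simp
    · rw [symIdxOf_comm, symIdxOf_of_le hgt.le]
      simp only [vecOfSym]
      rw [if_neg (Ne.symm h), hsym s t]
      field_simp

/-- `Σ_{(s,t)} g(s,t) = Σ_{s ≤ t} h(s,t)` when `h(s,s) = g(s,s)` and `h(s,t) = g(s,t) + g(t,s)`
(`s < t`). [folklore] -/
private theorem sum_prod_eq_sum_symIdx {k : ℕ} (g : Fin k × Fin k → ℝ) (h : SymIdx k → ℝ)
    (hdiag : ∀ s, h ⟨(s, s), le_rfl⟩ = g (s, s))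
    (hoff : ∀ s t (hst : s < t), h ⟨(s, t), hst.le⟩ = g (s, t) + g (t, s)) :
    ∑ p, g p = ∑ q, h q := by
  classical
  -- split the square into `s ≤ t` and `t < s`, and fold the latter onto `s < t`
  have h1 : ∑ p : Fin k × Fin k, g p =
      ∑ p ∈ univ.filter (fun p : Fin k × Fin k => p.1 ≤ p.2), g p +
        ∑ p ∈ univ.filter (fun p : Fin k × Fin k => p.1 < p.2), g p.swap := by
    rw [← sum_filter_add_sum_filter_not univ (fun p : Fin k × Fin k => p.1 ≤ p.2)]
    congr 1
    refine sum_equiv (Equiv.prodComm (Fin k) (Fin k)) (fun p => ?_) (fun p _ => ?_)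
    · simp only [mem_filter, mem_univ, true_and, not_le, Equiv.prodComm_apply, Prod.fst_swap,
        Prod.snd_swap]
    · simp only [Equiv.prodComm_apply, Prod.swap_swap]
  -- the right-hand side as a sum over `s ≤ t`
  have h2 : ∑ p ∈ univ.filter (fun p : Fin k × Fin k => p.1 ≤ p.2),
      (g p + if p.1 < p.2 then g p.swap else 0) = ∑ q : SymIdx k, h q := by
    rw [sum_subtype (univ.filter fun p : Fin k × Fin k => p.1 ≤ p.2)
      (p := fun p : Fin k × Fin k => p.1 ≤ p.2) (fun p => by simp)]
    refine sum_congr rfl fun q _ => ?_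
    obtain ⟨⟨s, t⟩, hst⟩ := q
    have hst' : s ≤ t := hst
    show (g (s, t) + if s < t then g (t, s) else 0) = h ⟨(s, t), hst⟩
    rcases hst'.lt_or_eq with hlt | heq
    · rw [if_pos hlt, hoff s t hlt]
    · cases heq
      rw [if_neg (lt_irrefl _), add_zero]
      exact (hdiag s).symm
  have h3 : ∑ p ∈ univ.filter (fun p : Fin k × Fin k => p.1 ≤ p.2),
      (g p + if p.1 < p.2 then g p.swap else 0) =
      ∑ p ∈ univ.filter (fun p : Fin k × Fin k => p.1 ≤ p.2), g p +
        ∑ p ∈ univ.filter (fun p : Fin k × Fin k => p.1 < p.2), g p.swap := by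
    rw [sum_add_distrib, sum_ite, sum_const_zero, add_zero, filter_filter]
    congr 2
    ext p
    simp only [mem_filter, mem_univ, true_and]
    exact ⟨fun h => h.2, fun h => ⟨h.le, h⟩⟩
  rw [h1, ← h2, h3]

/-- The bijection preserves the inner product: `⟨π₀ y, π₀ z⟩ = Tr(π₀(y) π₀(z)) = yᵀz`.
[cite: GouveiaRobinsonThomas2015, §4 (p09, "this bijection preserves the inner product in S^k")] -/
theorem trace_symOfVec_mul_symOfVec {k : ℕ} (y z : SymIdx k → ℝ) :
    (symOfVec y * symOfVec z).trace = y ⬝ᵥ z := by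
  classical
  have h1 : (symOfVec y * symOfVec z).trace =
      ∑ p : Fin k × Fin k, symOfVec y p.1 p.2 * symOfVec z p.1 p.2 := by
    simp only [trace, diag_apply, mul_apply]
    rw [← univ_product_univ, sum_product]
    refine sum_congr rfl fun s _ => sum_congr rfl fun t _ => ?_
    rw [show symOfVec z t s = symOfVec z s t by
      rw [← transpose_apply (symOfVec z) s t, symOfVec_transpose]]
  rw [h1, dotProduct]
  have hsq : Real.sqrt 2 * Real.sqrt 2 = 2 := Real.mul_self_sqrt (by norm_num)
  refine sum_prod_eq_sum_symIdx _ _ (fun s => ?_) (fun s t hst => ?_)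
  · show y _ * z _ = symOfVec y s s * symOfVec z s s
    rw [symOfVec_apply, symOfVec_apply, if_pos rfl, if_pos rfl, symIdxOf_of_le (le_refl s)]
  · have hne : s ≠ t := hst.ne
    show y _ * z _ = symOfVec y s t * symOfVec z s t + symOfVec y t s * symOfVec z t s
    simp only [symOfVec_apply, if_neg hne, if_neg hne.symm, symIdxOf_comm t s, symIdxOf_of_le hst.le]
    rw [div_mul_div_comm, hsq]
    ring

/-- `Tr(A B) = vec(A)ᵀ vec(B)` for symmetric `A, B`.
[cite: GouveiaRobinsonThomas2015, §4 (p09, the inner-product preserving bijection)] -/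
theorem trace_mul_eq_dotProduct_vecOfSym {k : ℕ} {A B : Matrix (Fin k) (Fin k) ℝ} (hA : Aᵀ = A)
    (hB : Bᵀ = B) : (A * B).trace = vecOfSym A ⬝ᵥ vecOfSym B := by
  have h := trace_symOfVec_mul_symOfVec (vecOfSym A) (vecOfSym B)
  rwa [symOfVec_vecOfSym hA, symOfVec_vecOfSym hB] at h

/-! ### Self-duality of `S^k_+` in coordinates -/

/-- `Tr(P Q) ≥ 0` for real psd `P, Q` (write `Q = CᵀC`). [folklore] -/
private theorem trace_mul_nonneg_of_posSemidef' {k : ℕ} {P Q : Matrix (Fin k) (Fin k) ℝ}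
    (hP : P.PosSemidef) (hQ : Q.PosSemidef) : 0 ≤ (P * Q).trace := by
  classical
  obtain ⟨C, hC⟩ := CStarAlgebra.nonneg_iff_eq_star_mul_self.mp hQ.nonneg
  have hQC : Q = Cᴴ * C := by rw [hC, star_eq_conjTranspose]
  have hsum : (P * Q).trace = ∑ l, star (star (C l)) ⬝ᵥ (P *ᵥ star (C l)) := by
    rw [hQC, ← Matrix.mul_assoc, Matrix.trace_mul_comm]
    simp only [Matrix.trace, Matrix.diag_apply, Matrix.mul_apply, Matrix.conjTranspose_apply,
      dotProduct, Matrix.mulVec, Finset.mul_sum, star_star, Pi.star_apply]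
  rw [hsum]
  exact Finset.sum_nonneg fun l _ => hP.dotProduct_mulVec_nonneg (star (C l))

/-- `xxᵀ ⪰ 0`. [folklore] -/
private theorem posSemidef_vecMulVec_self' {k : ℕ} (x : Fin k → ℝ) : (vecMulVec x x).PosSemidef := by
  refine PosSemidef.of_dotProduct_mulVec_nonneg ?_ fun w => ?_
  · rw [IsHermitian, conjTranspose_eq_transpose_of_trivial, transpose_vecMulVec]
  · have h : vecMulVec x x *ᵥ w = (x ⬝ᵥ w) • x := by
      funext i
      simp only [mulVec, dotProduct, vecMulVec_apply, Pi.smul_apply, smul_eq_mul, sum_mul]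
      exact sum_congr rfl fun j _ => by ring
    rw [h, star_trivial, dotProduct_smul, smul_eq_mul, dotProduct_comm w x]
    exact mul_self_nonneg _

/-- `yᵀz ≥ 0` whenever `π₀ y, π₀ z ⪰ 0` (`= ⟨π₀ y, π₀ z⟩`).
[cite: GouveiaRobinsonThomas2015, §4 (p09, "for every matrix A ∈ S^k_+, v_jᵀ(π(A)) ≥ 0")] -/
theorem dotProduct_nonneg_of_posSemidef_symOfVec {k : ℕ} {y z : SymIdx k → ℝ}
    (hy : (symOfVec y).PosSemidef) (hz : (symOfVec z).PosSemidef) : 0 ≤ y ⬝ᵥ z := by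
  rw [← trace_symOfVec_mul_symOfVec]
  exact trace_mul_nonneg_of_posSemidef' hy hz

/-- `((Ly)ᵀ V)_j = yᵀ (v_jᵀ L)` for the column `v_j` of `V`. [folklore] -/
private theorem vecMul_mulVec_apply' {σ : Type*} [Fintype σ] {q : ℕ} (L : Matrix σ σ ℝ)
    (y : σ → ℝ) (V : Matrix σ (Fin q) ℝ) (j : Fin q) :
    ((L *ᵥ y) ᵥ* V) j = y ⬝ᵥ ((fun l => V l j) ᵥ* L) := by
  rw [dotProduct_comm, ← dotProduct_mulVec, dotProduct_comm]
  rfl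

/-- Self-duality of `S^k_+` in the coordinates `π₀`: `π₀ z ⪰ 0` iff `yᵀz ≥ 0` for every `y` with
`π₀ y ⪰ 0` (test with `π₀ y = xxᵀ`: `yᵀz = xᵀ π₀(z) x`). [cite: GouveiaRobinsonThomas2015, §4 (p09,
"for every matrix A ∈ S^k_+, v_jᵀ(π(A)) ≥ 0. Therefore [...] the symmetric matrix corresponding to v_jᵀL is psd")] -/
theorem posSemidef_symOfVec_iff {k : ℕ} (z : SymIdx k → ℝ) :
    (symOfVec z).PosSemidef ↔ ∀ y, (symOfVec y).PosSemidef → 0 ≤ y ⬝ᵥ z := by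
  refine ⟨fun hz y hy => dotProduct_nonneg_of_posSemidef_symOfVec hy hz, fun h => ?_⟩
  refine PosSemidef.of_dotProduct_mulVec_nonneg (symOfVec_isHermitian z) fun x => ?_
  have hxx : symOfVec (vecOfSym (vecMulVec x x)) = vecMulVec x x :=
    symOfVec_vecOfSym (transpose_vecMulVec x x)
  have h1 := h (vecOfSym (vecMulVec x x)) (by rw [hxx]; exact posSemidef_vecMulVec_self' x)
  rw [← trace_symOfVec_mul_symOfVec, hxx] at h1
  have h2 : (vecMulVec x x * symOfVec z).trace = star x ⬝ᵥ symOfVec z *ᵥ x := by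
    rw [star_trivial]
    simp only [trace, diag_apply, mul_apply, vecMulVec_apply, dotProduct, mulVec, Finset.mul_sum]
    rw [Finset.sum_comm]
    exact sum_congr rfl fun i _ => sum_congr rfl fun j _ => by ring
  rwa [h2] at h1

/-! ### Rank factorizations differ by an invertible matrix -/

/-- A matrix of full row rank has a right inverse. [folklore] -/
private theorem exists_mul_eq_one_of_rank_eq_card_rows {m n : Type*} [Fintype m] [Fintype n]
    [DecidableEq m] [DecidableEq n] (V : Matrix m n ℝ) (hV : V.rank = Fintype.card m) :
    ∃ W : Matrix n m ℝ, V * W = 1 := by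
  have hsurj : LinearMap.range V.mulVecLin = ⊤ := by
    apply Submodule.eq_top_of_finrank_eq
    rw [Module.finrank_fintype_fun_eq_card]
    exact hV
  obtain ⟨g, hg⟩ := LinearMap.exists_rightInverse_of_surjective _ hsurj
  refine ⟨LinearMap.toMatrix' g, ?_⟩
  have h1 : LinearMap.toMatrix' (V.mulVecLin ∘ₗ g) = 1 := by rw [hg, LinearMap.toMatrix'_id]
  have h2 : LinearMap.toMatrix' V.mulVecLin = V := LinearMap.toMatrix'_toLin' V
  rwa [LinearMap.toMatrix'_comp, h2] at h1

/-- A matrix of full column rank has a left inverse. [folklore] -/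
private theorem exists_mul_eq_one_of_rank_eq_card_cols {m n : Type*} [Fintype m] [Fintype n]
    [DecidableEq m] [DecidableEq n] (U : Matrix m n ℝ) (hU : U.rank = Fintype.card n) :
    ∃ Z : Matrix n m ℝ, Z * U = 1 := by
  obtain ⟨W, hW⟩ := exists_mul_eq_one_of_rank_eq_card_rows Uᵀ (by rw [rank_transpose]; exact hU)
  refine ⟨Wᵀ, ?_⟩
  have h := congrArg transpose hW
  rwa [transpose_mul, transpose_transpose, transpose_one] at h

/-- Two rank factorizations `UV = ÂB̂` of a matrix of rank `d` (inner dimension `d`) differ by an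
invertible `d × d` matrix: `Â = UG`, `B̂ = G⁻¹V`. [folklore] -/
private theorem exists_conj_of_rank_factorizations {m n σ : Type*} [Fintype m] [Fintype n]
    [Fintype σ] [DecidableEq m] [DecidableEq n] [DecidableEq σ] {U A : Matrix m σ ℝ}
    {V B : Matrix σ n ℝ} (h : U * V = A * B) (hr : (U * V).rank = Fintype.card σ) :
    ∃ G K : Matrix σ σ ℝ, G * K = 1 ∧ K * G = 1 ∧ A = U * G ∧ B = K * V := by
  have hU : U.rank = Fintype.card σ :=
    le_antisymm (rank_le_card_width U) (by rw [← hr]; exact rank_mul_le_left U V)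
  have hVr : V.rank = Fintype.card σ :=
    le_antisymm (rank_le_card_height V) (by rw [← hr]; exact rank_mul_le_right U V)
  have hBr : B.rank = Fintype.card σ :=
    le_antisymm (rank_le_card_height B) (by rw [← hr, h]; exact rank_mul_le_right A B)
  obtain ⟨Z, hZ⟩ := exists_mul_eq_one_of_rank_eq_card_cols U hU
  obtain ⟨WB, hWB⟩ := exists_mul_eq_one_of_rank_eq_card_rows B hBr
  obtain ⟨WV, hWV⟩ := exists_mul_eq_one_of_rank_eq_card_rows V hVr
  have hUG : U * (V * WB) = A := by
    rw [← Matrix.mul_assoc, h, Matrix.mul_assoc, hWB, Matrix.mul_one]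
  have hAK : A * (B * WV) = U := by
    rw [← Matrix.mul_assoc, ← h, Matrix.mul_assoc, hWV, Matrix.mul_one]
  have hGK : V * WB * (B * WV) = 1 := by
    calc V * WB * (B * WV) = Z * U * (V * WB * (B * WV)) := by rw [hZ, Matrix.one_mul]
      _ = Z * (U * (V * WB) * (B * WV)) := by simp only [Matrix.mul_assoc]
      _ = 1 := by rw [hUG, hAK, hZ]
  have hKG : B * WV * (V * WB) = 1 := mul_eq_one_comm.mp hGK
  refine ⟨V * WB, B * WV, hGK, hKG, hUG.symm, ?_⟩
  have hV : V = V * WB * B := by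
    calc V = Z * U * V := by rw [hZ, Matrix.one_mul]
      _ = Z * (A * B) := by rw [Matrix.mul_assoc, h]
      _ = Z * (U * (V * WB) * B) := by rw [hUG]
      _ = Z * U * (V * WB * B) := by simp only [Matrix.mul_assoc]
      _ = V * WB * B := by rw [hZ, Matrix.one_mul]
  calc B = 1 * B := (Matrix.one_mul B).symm
    _ = B * WV * (V * WB) * B := by rw [hKG]
    _ = B * WV * (V * WB * B) := by simp only [Matrix.mul_assoc]
    _ = B * WV * V := by rw [← hV]

/-- **Rank factorizations exist** (p08: "Let `M = UV` be a rank factorization"): a matrix of rank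
`|σ|` factors through `ℝ^σ` — `U` = `|σ|` columns of `M` spanning the column space, `V` = the
coordinates of all columns in them. With `σ = SymIdx k` (`card_symIdx`) this produces the data of
Propositions 4.4–4.5 for any `M` of rank `C(k+1,2)`.
[cite: GouveiaRobinsonThomas2015, §4 (p08, "Let M = UV be a rank factorization")] -/
theorem exists_rank_factorization_of_card_eq {p q : ℕ} {σ : Type*} [Fintype σ] (M : Matrix (Fin p) (Fin q) ℝ)
    (hσ : Fintype.card σ = M.rank) :
    ∃ (U : Matrix (Fin p) σ ℝ) (V : Matrix σ (Fin q) ℝ), M = U * V := by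
  classical
  obtain ⟨t, ht_sub, ht_span, ht_li⟩ := exists_linearIndependent ℝ (Set.range M.col)
  have ht_fin : t.Finite := (Set.finite_range _).subset ht_sub
  letI : Fintype t := ht_fin.fintype
  have hcard : Fintype.card t = Fintype.card σ := by
    rw [← Set.toFinset_card, ← finrank_span_set_eq_card ht_li, ht_span,
      ← Matrix.rank_eq_finrank_span_cols, hσ]
  let e : σ ≃ t := Fintype.equivOfCardEq hcard.symm
  have hJ : ∀ l : σ, ∃ j : Fin q, M.col j = (e l : Fin p → ℝ) := fun l => ht_sub (e l).2
  choose J hJ using hJ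
  have hrange : Set.range (fun l : σ => (e l : Fin p → ℝ)) = t := by
    ext v
    constructor
    · rintro ⟨l, rfl⟩; exact (e l).2
    · intro hv; exact ⟨e.symm ⟨v, hv⟩, by simp⟩
  have hC : ∀ j : Fin q, ∃ cj : σ → ℝ, ∑ l, cj l • (e l : Fin p → ℝ) = M.col j := fun j => by
    rw [← Submodule.mem_span_range_iff_exists_fun ℝ, hrange, ht_span]
    exact Submodule.subset_span ⟨j, rfl⟩
  choose C hC using hC
  refine ⟨fun i l => M i (J l), fun l j => C j l, ?_⟩
  ext i j
  have h := congrFun (hC j) i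
  simp only [Finset.sum_apply, Pi.smul_apply, smul_eq_mul] at h
  rw [Matrix.mul_apply, show M i j = M.col j i from rfl, ← h]
  refine sum_congr rfl fun l _ => ?_
  rw [← hJ l, mul_comm]
  rfl

/-! ### The cones `P`, `Q`, `π(S^k_+)` and the dimension count -/

/-- `P = cone(u_1, …, u_p)`, the cone generated by the rows of `U`.
[cite: GouveiaRobinsonThomas2015, §4 (p08, "P = cone(u_1,…,u_p)")] -/
def rowCone {p : ℕ} {σ : Type*} (U : Matrix (Fin p) σ ℝ) : Set (σ → ℝ) :=
  {x | ∃ c : Fin p → ℝ, (∀ i, 0 ≤ c i) ∧ x = ∑ i, c i • U i}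

/-- `Q = {x ∈ ℝ^d | xᵀV ≥ 0}`. [cite: GouveiaRobinsonThomas2015, §4 (p08, "Q = {x ∈ ℝ^d | xᵀV ≥ 0}")] -/
def colDualCone {q : ℕ} {σ : Type*} [Fintype σ] (V : Matrix σ (Fin q) ℝ) : Set (σ → ℝ) :=
  {x | ∀ j, 0 ≤ (x ᵥ* V) j}

/-- `π(S^k_+) ⊆ ℝ^d` for the linear map `π : S^k → ℝ^d` with matrix `L` in the basis `E_ij`
(`π(Y) = Ly`, p09). [cite: GouveiaRobinsonThomas2015, §4 (p09, "π(Y) = Ly")] -/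
def psdConeImage {k : ℕ} (L : Matrix (SymIdx k) (SymIdx k) ℝ) : Set (SymIdx k → ℝ) :=
  (fun y => L *ᵥ y) '' {y | (symOfVec y).PosSemidef}

/-- The generators `u_i` lie in `P`. [cite: GouveiaRobinsonThomas2015, §4 (p08)] -/
theorem row_mem_rowCone {p : ℕ} {σ : Type*} (U : Matrix (Fin p) σ ℝ) (i : Fin p) :
    U i ∈ rowCone U := by
  classical
  refine ⟨fun l => if l = i then 1 else 0, fun l => by by_cases h : l = i <;> simp [h], ?_⟩
  simp only [ite_smul, one_smul, zero_smul, sum_ite_eq', mem_univ, if_true]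

/-- "The condition that `P ⊆ π(S^k_+)` is equivalent to `π⁻¹(u_i) ∈ S^k_+` for every generator `u_i`
of `P`" — here: `P ⊆ π(S^k_+)` iff every generator lies in the convex cone `π(S^k_+)`.
[cite: GouveiaRobinsonThomas2015, §4 (p09)] -/
theorem rowCone_subset_psdConeImage_iff {p k : ℕ} {U : Matrix (Fin p) (SymIdx k) ℝ}
    {L : Matrix (SymIdx k) (SymIdx k) ℝ} :
    rowCone U ⊆ psdConeImage L ↔ ∀ i, U i ∈ psdConeImage L := by
  refine ⟨fun h i => h (row_mem_rowCone U i), fun h => ?_⟩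
  have h' : ∀ i, ∃ y : SymIdx k → ℝ, (symOfVec y).PosSemidef ∧ L *ᵥ y = U i := fun i => by
    obtain ⟨y, hy, e⟩ := h i
    exact ⟨y, hy, e⟩
  choose y hy hUy using h'
  rintro x ⟨c, hc, rfl⟩
  refine ⟨∑ i, c i • y i, ?_, ?_⟩
  · show (symOfVec (∑ i, c i • y i)).PosSemidef
    rw [map_sum]
    refine Finset.sum_induction _ (fun A : Matrix (Fin k) (Fin k) ℝ => A.PosSemidef)
      (fun _ _ ha hb => ha.add hb) PosSemidef.zero (fun i _ => ?_)
    rw [map_smul]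
    exact (hy i).smul (hc i)
  · show L *ᵥ (∑ i, c i • y i) = ∑ i, c i • U i
    simp only [← hUy]
    change L.mulVecLin (∑ i, c i • y i) = ∑ i, c i • L.mulVecLin (y i)
    simp only [map_sum, map_smul]

/-- **The dimension count** (p08: "Let `M` be a nonnegative matrix of rank `d = C(k+1,2)`. Then by a
dimension count, `rank_psd(M) ≥ k`"): a psd factorization of size `j` of a matrix of rank `C(k+1,2)`
has `j ≥ k` (`rank ≤ C(j+1,2)`, FGPRT Prop. 2.5). [cite: GouveiaRobinsonThomas2015, §4 (p08)] -/
theorem le_of_hasPsdFactorization_of_rank_eq {p q k j : ℕ} {U : Matrix (Fin p) (SymIdx k) ℝ}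
    {V : Matrix (SymIdx k) (Fin q) ℝ} (hrank : (U * V).rank = Fintype.card (SymIdx k))
    (h : HasPsdFactorization (U * V) j) : k ≤ j := by
  by_contra hcon
  have hlt : j < k := Nat.lt_of_not_le hcon
  have h1 : (U * V).rank ≤ (j + 1).choose 2 := h.rank_le_choose
  rw [hrank, card_symIdx] at h1
  have h2 : (j + 1).choose 2 ≤ k.choose 2 := Nat.choose_le_choose 2 (Nat.succ_le_of_lt hlt)
  have h3 : (k + 1).choose 2 = k + k.choose 2 := by
    rw [Nat.choose_succ_succ', Nat.choose_one_right]
  omega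

/-! ### Proposition 4.5 and Proposition 4.4 -/

/-- **GRT15 Proposition 4.5** (MIN PSD RANK as an LMI system). For a rank factorization `M = UV`
with inner dimension `d = C(k+1,2) = rank M` (indexed by `SymIdx k ≅ S^k`): `M` has a psd
factorization of size `k` iff there are `L, K ∈ ℝ^{d×d}` with `LK = KL = I`, `Ku_i ⪰ 0` for each
row `u_i` of `U` and `v_jᵀL ⪰ 0` for each column `v_j` of `V` (as symmetric matrices under `π₀`).
(`⇐`: `A_i = π₀(Ku_i)`, `B_j = π₀(v_jᵀL)`, `⟨A_i,B_j⟩ = u_iᵀKᵀLᵀv_j = M_ij`; `⇒`: a size-`k` psd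
factorization is a second rank factorization `M = ÂB̂` through the coordinates `vec`, and
`Â = UG`, `B̂ = G⁻¹V` with `G` invertible; `K = Gᵀ`, `L = (G⁻¹)ᵀ`.) Nonnegativity of `M` is not used.
[cite: GouveiaRobinsonThomas2015, Prop. 4.5 (p09)] -/
theorem GouveiaRobinsonThomas2015_prop45 {p q k : ℕ} (U : Matrix (Fin p) (SymIdx k) ℝ)
    (V : Matrix (SymIdx k) (Fin q) ℝ) (hrank : (U * V).rank = Fintype.card (SymIdx k)) :
    HasPsdFactorization (U * V) k ↔ ∃ L K : Matrix (SymIdx k) (SymIdx k) ℝ,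
      L * K = 1 ∧ K * L = 1 ∧ (∀ i, (symOfVec (K *ᵥ U i)).PosSemidef) ∧
        ∀ j, (symOfVec ((fun l => V l j) ᵥ* L)).PosSemidef := by
  classical
  constructor
  · rintro ⟨A, B, hA, hB, hM⟩
    have hAs : ∀ i, (A i)ᵀ = A i := fun i => by
      have h := (hA i).1
      rwa [IsHermitian, conjTranspose_eq_transpose_of_trivial] at h
    have hBs : ∀ j, (B j)ᵀ = B j := fun j => by
      have h := (hB j).1
      rwa [IsHermitian, conjTranspose_eq_transpose_of_trivial] at h
    -- the second rank factorization, through the coordinates `vec`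
    let Ah : Matrix (Fin p) (SymIdx k) ℝ := fun i => vecOfSym (A i)
    let Bh : Matrix (SymIdx k) (Fin q) ℝ := fun l j => vecOfSym (B j) l
    have hfac : U * V = Ah * Bh := by
      ext i j
      rw [hM i j, trace_mul_eq_dotProduct_vecOfSym (hAs i) (hBs j), Matrix.mul_apply]
      rfl
    obtain ⟨G, K, hGK, hKG, hAG, hBK⟩ := exists_conj_of_rank_factorizations hfac hrank
    refine ⟨Kᵀ, Gᵀ, ?_, ?_, fun i => ?_, fun j => ?_⟩
    · rw [← transpose_mul, hGK, transpose_one]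
    · rw [← transpose_mul, hKG, transpose_one]
    · have hrow : Gᵀ *ᵥ U i = vecOfSym (A i) := by
        funext l
        have hl : vecOfSym (A i) l = (U * G) i l := congrFun (congrFun hAG i) l
        rw [Matrix.mul_apply] at hl
        rw [hl]
        simp only [mulVec, dotProduct, transpose_apply]
        exact sum_congr rfl fun x _ => mul_comm _ _
      rw [hrow, symOfVec_vecOfSym (hAs i)]
      exact hA i
    · have hcol : (fun l => V l j) ᵥ* Kᵀ = vecOfSym (B j) := by
        funext l
        have hl : vecOfSym (B j) l = (K * V) l j := congrFun (congrFun hBK l) j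
        rw [Matrix.mul_apply] at hl
        rw [hl]
        simp only [vecMul, dotProduct, transpose_apply]
        exact sum_congr rfl fun x _ => mul_comm _ _
      rw [hcol, symOfVec_vecOfSym (hBs j)]
      exact hB j
  · rintro ⟨L, K, hLK, -, hKU, hVL⟩
    refine ⟨fun i => symOfVec (K *ᵥ U i), fun j => symOfVec ((fun l => V l j) ᵥ* L), hKU, hVL,
      fun i j => ?_⟩
    rw [trace_symOfVec_mul_symOfVec, dotProduct_comm, ← dotProduct_mulVec, mulVec_mulVec, hLK,
      one_mulVec, Matrix.mul_apply, dotProduct]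
    exact sum_congr rfl fun l _ => mul_comm _ _

/-- **GRT15 Proposition 4.4** (geometric characterization of MIN PSD RANK). For a rank factorization
`M = UV` with inner dimension `d = C(k+1,2) = rank M` and the cones `P = cone(u_i)`,
`Q = {x | xᵀV ≥ 0}`: `M` has a psd factorization of size `k` (i.e. `rank_psd M = k`, the least value
the dimension count `le_of_hasPsdFactorization_of_rank_eq` allows) iff there is an invertible linear
map `π : S^k → ℝ^d` (matrix `L` in the basis `E_ij`) with `P ⊆ π(S^k_+) ⊆ Q`. From Proposition 4.5
and the self-duality `posSemidef_symOfVec_iff`. [cite: GouveiaRobinsonThomas2015, Prop. 4.4 (p08)] -/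
theorem GouveiaRobinsonThomas2015_prop44 {p q k : ℕ} (U : Matrix (Fin p) (SymIdx k) ℝ)
    (V : Matrix (SymIdx k) (Fin q) ℝ) (hrank : (U * V).rank = Fintype.card (SymIdx k)) :
    HasPsdFactorization (U * V) k ↔ ∃ L : Matrix (SymIdx k) (SymIdx k) ℝ,
      IsUnit L ∧ rowCone U ⊆ psdConeImage L ∧ psdConeImage L ⊆ colDualCone V := by
  rw [GouveiaRobinsonThomas2015_prop45 U V hrank]
  constructor
  · rintro ⟨L, K, hLK, hKL, hKU, hVL⟩
    refine ⟨L, ⟨⟨L, K, hLK, hKL⟩, rfl⟩, ?_, ?_⟩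
    · rw [rowCone_subset_psdConeImage_iff]
      intro i
      exact ⟨K *ᵥ U i, hKU i, by simp only [mulVec_mulVec, hLK, one_mulVec]⟩
    · rintro x ⟨y, hy, rfl⟩ j
      rw [vecMul_mulVec_apply']
      exact dotProduct_nonneg_of_posSemidef_symOfVec hy (hVL j)
  · rintro ⟨L, ⟨u, hu⟩, hP, hQ⟩
    have hLK : L * (↑u⁻¹ : Matrix (SymIdx k) (SymIdx k) ℝ) = 1 := by rw [← hu, Units.mul_inv]
    have hKL : (↑u⁻¹ : Matrix (SymIdx k) (SymIdx k) ℝ) * L = 1 := by rw [← hu, Units.inv_mul]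
    refine ⟨L, ↑u⁻¹, hLK, hKL, fun i => ?_, fun j => ?_⟩
    · obtain ⟨y, hy, hUy⟩ := (rowCone_subset_psdConeImage_iff.mp hP) i
      have : (↑u⁻¹ : Matrix (SymIdx k) (SymIdx k) ℝ) *ᵥ U i = y := by
        rw [← hUy, mulVec_mulVec, hKL, one_mulVec]
      rw [this]
      exact hy
    · refine (posSemidef_symOfVec_iff _).mpr fun y hy => ?_
      have hmem : L *ᵥ y ∈ colDualCone V := hQ ⟨y, hy, rfl⟩
      have hj := hmem j
      rwa [vecMul_mulVec_apply'] at hj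

end Literature.Combinatorics.Optimization
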